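import Summits.FinalStateConjecture.FinalStateConjecture.Theses.LaminatedThreshold
import Summits.FinalStateConjecture.FinalStateConjecture.Cruxes.TameExitsLocalise.Lines.birth
import Summits.FinalStateConjecture.FinalStateConjecture.Theorems.LaminatedThresholdTameExitsLocaliseTailGluing

/-!
# Line skeleton `IdeatorK2Sketch` (§2 badness-transfers) for crux `LaminatedThreshold.TameExitsLocalise`
(stmt-FinalStateConjecture-16894) — line lead prover-line-stmt-FinalStateConjecture-16894-0 · 2026-08-17

The picked line (`Cruxes/TameExitsLocalise/IdeatorK2Sketch.lean` §"Idea 2", composition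
`tameExitsLocalise_of_nakedTransfer : NakedTransferAtExits → TameExitsLocalise`) reshaped into the stubs the crux AS TYPED
actually needs, in the birth skeleton's vocabulary (`Birth.Good`, `Birth.NoKillingTail`, `Birth.ParametricTailGluing`,
`Birth.KillingTailCase`):

* GLUING (birth S1) is CLOSED modulo one named fact: `coreTailGluing :
  Literature.Geometry.Lorentzian.ChruscielDelay_parametricAnnulusGluing → Birth.ParametricTailGluing` is the landed
  `Theorems.LaminatedThreshold.TailGluing.parametricTailGluing_of_annulusGluing` (p162514, from the accepted fact p161756).
  It delivers the line's glued LOCAL family `L` (`= d⋆` off one compact set, `= F c` off `e.far R₁` on a window).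
* `stub_badnessTransfer : BadnessTransfer` — THE LOAD-BEARING STUB. The k2 kit `NakedTransferAt` quantifies an abstract
  certificate `Naked` with (NT) locality, (NL) naked ⇒ exceptional, (CB) bad glued members are naked; the composition only
  ever consumes their composite `¬ Good (L c) → ¬ Good (F c)` on a punctured window, so the stub is stated as exactly that
  implication (with a threshold radius `R⋆` beyond which the core must be kept, as in birth S2), under ALL hypotheses the crux
  offers (`¬ Good d⋆`, tame + immersed + injective + admissible exit with all `c ≠ 0` good, `NoKillingTail`). It is birth's
  S2 `GoodnessTailRobust` in contrapositive form with the two hypotheses seat 0 asked for added; any proof via naked tips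
  (NT ∘ NL ∘ CB) or via stability theory proves it. STATUS: false as typed at the strategist's dirty-tailed datum `d_GO`
  modulo (β) (STRATEGY-CENSUS.md §Negation; Ideas/badness-transfers.md l.34) — see `Lines/IdeatorK2Sketch.dead.md`.
* `stub_killingTailCase : Birth.KillingTailCase` — birth S3 verbatim, the residual Killing-tail case (the crux on that
  subclass; no mechanism inside the line).

`TameExitsLocalise_of : stub_badnessTransfer → stub_killingTailCase → stub_annulusGluingFact → TameExitsLocalise` is
kernel-checked below; `stub_annulusGluingFact` IS the named fact `ChruscielDelay_parametricAnnulusGluing` (the skeleton audit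
admits no foreign hypothesis, so the fact is registered as the line's third stub = literature-prover debt).
-/

noncomputable section

set_option linter.dupNamespace false

namespace Summit.FinalStateConjecture.FinalStateConjecture.Cruxes.TameExitsLocalise.BadnessTransfer

open scoped Manifold ContDiff Topology
open Literature.Geometry.Lorentzian
open Summit.FinalStateConjecture.FinalStateConjecture.Theses.LaminatedThreshold
open Summit.FinalStateConjecture.FinalStateConjecture.Cruxes.TameExitsLocalise.Birth
  (Good NoKillingTail HasChartKID ParametricTailGluing KillingTailCase)

/-! ## Gluing — closed modulo the Chruściel–Delay parametric annular gluing fact -/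

/-- **Core–tail gluing (birth S1), from the named fact** (`NoKillingTail` / `HasChartKID` unfold definitionally to the
fact-consumer's inlined hypothesis). -/
theorem coreTailGluing (h : ChruscielDelay_parametricAnnulusGluing) : ParametricTailGluing :=
  fun X _ _ _ _ _ _ e dstar F hd hF himm h0 hinj hadm hnokid R₀ ↦
    Theorems.LaminatedThreshold.TailGluing.parametricTailGluing_of_annulusGluing h X e dstar F hd hF himm h0 hinj hadm
      hnokid R₀

/-! ## The stub statements -/

/-- **T2 — BADNESS TRANSFERS FROM THE GLUED LOCAL MEMBER TO THE EXIT MEMBER (load-bearing).** For an admissible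
EXCEPTIONAL `d⋆` with a tame, immersed, injective, admissible exit `F` on the end `e`, all members `c ≠ 0` good, and
KID-free far annuli, there is a threshold radius `R⋆` such that for every `R₁ ≥ R⋆` and every jointly smooth admissible
family `L` through `d⋆` which equals `d⋆` off a compact set and equals `F c` off `e.far R₁` for all small `c`, on some
punctured window a BAD glued member `L c` forces a bad exit member `F c`. (Intended proof, k2: a bad `L c` is bad through
a naked tip born over the shared core (CB), tips transfer between data agreeing on the core (NT), a naked tip contradicts
`Good (F c)` (NL). Equivalent, given the hypotheses, to `Good (L c)` on the window.) -/
def BadnessTransfer : Prop :=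
  ∀ (X : Type) [TopologicalSpace X] [ChartedSpace E3 X] [IsManifold (𝓡 3) ∞ X] [T2Space X]
    [SecondCountableTopology X] [ConnectedSpace X] (e : AFEnd X) (dstar : InitialDataSet (𝓡 3) X)
    (F : EuclideanSpace ℝ (Fin 1) → InitialDataSet (𝓡 3) X),
    dstar ∈ admissibleVacuumData X → ¬ Good dstar →
    InitialDataSet.IsTameDataFamily e 1 F → InitialDataSet.IsImmersedAtZero 1 F → F 0 = dstar →
    Function.Injective F → (∀ c, F c ∈ admissibleVacuumData X) → (∀ c, c ≠ 0 → Good (F c)) →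
    NoKillingTail e dstar →
    ∃ Rstar : ℝ, ∀ R₁ : ℝ, Rstar ≤ R₁ →
      ∀ L : EuclideanSpace ℝ (Fin 1) → InitialDataSet (𝓡 3) X,
        InitialDataSet.IsSmoothDataFamily 1 L → L 0 = dstar → (∀ c, L c ∈ admissibleVacuumData X) →
        (∃ C : Set X, IsCompact C ∧
          ∀ c, ∀ x ∉ C, (L c).h.inner x = dstar.h.inner x ∧ (L c).k x = dstar.k x) →
        (∃ ε₁ : ℝ, 0 < ε₁ ∧
          ∀ c, ‖c‖ < ε₁ → ∀ x ∉ e.far R₁, (L c).h.inner x = (F c).h.inner x ∧ (L c).k x = (F c).k x) →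
        ∃ ε : ℝ, 0 < ε ∧ ∀ c, c ≠ 0 → ‖c‖ < ε → ¬ Good (L c) → ¬ Good (F c)

/-! ## The stubs (the only `sorry`s of the file) -/

/-- **T2 `stub_badnessTransfer`** — research-open; FALSE as typed at dirty-tailed exceptional data (`d_GO`, mod β). -/
theorem stub_badnessTransfer : BadnessTransfer := by
  sorry

/-- **T3 `stub_killingTailCase`** — birth S3 verbatim (residual case: the crux on the Killing-tailed subclass). -/
theorem stub_killingTailCase : KillingTailCase := by
  sorry

/-- **T1 `stub_annulusGluingFact`** — the NAMED LITERATURE FACT the gluing rests on (Chruściel–Delay 2003 Thm 5.9 /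
Cor 5.11, Chruściel–Delay 2004 Thm 6.6, Corvino–Schoen 2006 Thm 2, parametric form; accepted as
`Literature.Geometry.Lorentzian.ChruscielDelay_parametricAnnulusGluing`, p161756, UNPROVED in the tree). Registered as a
stub only because the skeleton audit admits no foreign hypothesis in `TameExitsLocalise_of`; it is literature-prover debt,
not line work (discharging it = `ChruscielDelay_parametricAnnulusGluing_holds`). -/
theorem stub_annulusGluingFact : ChruscielDelay_parametricAnnulusGluing := by
  sorry

/-! ## Name-keyed aliases (device of `Lines/birth.lean`) -/
namespace __Registered

/-- Alias of `BadnessTransfer` keyed by the registered stub name. -/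
abbrev stub_badnessTransfer : Prop := BadnessTransfer
/-- Alias of `KillingTailCase` keyed by the registered stub name. -/
abbrev stub_killingTailCase : Prop := KillingTailCase
/-- Alias of the named fact keyed by the registered stub name. -/
abbrev stub_annulusGluingFact : Prop := ChruscielDelay_parametricAnnulusGluing

end __Registered

/-! ## The composition (kernel-checked; conditional on the one named fact) -/

/-- **`TameExitsLocalise` from T2, T3 and the Chruściel–Delay fact.** KID-free case: take `R⋆` from T2, glue at
`R₀ := R⋆` (S1 from the fact) to get `R₁ ≥ R⋆`, the local family `L` and its core-agreement window, read the badness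
window off T2 at `(R₁, L)` and contrapose against `Good (F c)`; Killing-tail case: T3. -/
theorem TameExitsLocalise_of :
    __Registered.stub_badnessTransfer → __Registered.stub_killingTailCase →
      __Registered.stub_annulusGluingFact → TameExitsLocalise := by
  intro htrans hkill hfact X _ _ _ _ _ _ dstar hD hbad hexit
  obtain ⟨e, F, hF, himm, h0, hinj, hadm, hgood⟩ := hexit
  by_cases htail : NoKillingTail e dstar
  · obtain ⟨Rstar, hR⟩ := htrans X e dstar F hD hbad hF himm h0 hinj hadm hgood htail
    obtain ⟨R₁, hR₁, L, ε₁, hL, himm', h0', hinj', hadm', hC', hε₁, hcore⟩ :=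
      coreTailGluing hfact X e dstar F hD hF himm h0 hinj hadm htail Rstar
    obtain ⟨ε, hε, hwin⟩ := hR R₁ hR₁ L hL h0' hadm' hC' ⟨ε₁, hε₁, hcore⟩
    refine ⟨L, hL, himm', h0', hinj', hadm', hC', ε, hε, fun c hc hcε ↦ ?_⟩
    by_contra hLbad
    exact hwin c hc hcε hLbad (hgood c hc)
  · exact hkill X e dstar F hD hbad hF himm h0 hinj hadm hgood htail

/-- WIRING CHECK (an `example`, so no pre-composed constant enters the environment). -/
example : TameExitsLocalise :=
  TameExitsLocalise_of stub_badnessTransfer stub_killingTailCase stub_annulusGluingFact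

end Summit.FinalStateConjecture.FinalStateConjecture.Cruxes.TameExitsLocalise.BadnessTransfer

end
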